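import Summits.AnomalousDissipation.AnomalousDissipation.Theorems.SolenoidalFractalHomogenisationLadderFunctionalDecay
import HarnessLib

/-!
# K2R `RealisedQuasiStaticCellLaw`, line `floquet-bloch`, stub `stub_lowSectorDecay` (S1D): tridiagonal ladders

Summits-side helper (everything proved; no definitions, no named facts; `--supports stmt-AnomalousDissipation-20446`).
Third file of brick (F2) of the S1D stub plan §3.3 (cell `ad-ideate`, planner ad-p1 gen 15): the abstract hypotheses on
the coupling matrix `S` in `ladderFunctional_deriv_le` / `ladderFunctional_decay` (files
`…LadderFunctional`, `…LadderFunctionalDecay`) — `S o o = 0`, `γ² = Σ_J ‖S_{oJ}‖² ≤ 2`, second ring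
`Σ_{K ≠ o} ‖(S²)_{oK}‖² ≤ 4γ²` — are DISCHARGED for the matrices the plan actually names: TRIDIAGONAL skew-Hermitian
`S` with entries of modulus `≤ 1` along an injective position map `pos : ι → ℤ` (`S_{JK} ≠ 0 ⟹ pos K = pos J ± 1`). This is the Fourier ladder `J ↦ q + J k_j m̂_j` of one Bloch block inside one slot
(`(Sv)_J = s_{J−1}v_{J−1} − s_J v_{J+1}`, `|s_J| ≤ 1`), for ANY finite truncation `ι` of it.

* `card_filter_adjacent_le_two`: at most two indices sit next to a given position;
* `tridiagonal_diag_eq_zero`, `tridiagonal_row_sq_le_two`, `tridiagonal_secondRing_le`: the three discharges;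
* `ladderFunctional_decay_tridiagonal`: `ladderFunctional_decay_explicit` with the tridiagonal hypotheses in place
  of the abstract ones (only `0 < γ²`, i.e. the slow mode IS coupled, remains — the good slot of
  `cubatureWord_exists_goodPhase` guarantees it);
* `ladderFunctional_decay_intWindow`: the CONSUMER form (K2R lead's INTERFACE NOTE 2026-08-27): window `W ⊆ ℤ`
  containing `−1, 0, 1`, state `v : ℝ → ℤ → ℂ` vanishing off `W` (Dirichlet truncation), links `s : ℤ → ℝ`, damping
  `d : ℤ → ℝ` with hypotheses only on `W`, per-coordinate `HasDerivWithinAt … (Icc t₀ t₁) t` in original time with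
  the rate `Λ` multiplying the right-hand side, `γ² = s₀² + s₋₁²`.

Citation context (ad-lit g17, LIT-PACK §43b): the functional is the finite-dimensional form of the
Dolbeault–Mouhot–Schmeiser `L²`-hypocoercivity modified entropy (Trans. AMS 367 (2015) §1.3 Thm 2, §1.4) in the
matrix bookkeeping of Achleitner–Arnold–Mehrmann (ZAMM 103 (2023) §2.4); the frozen-`β`, time-dependent-`g`,
tridiagonally normalised inequality itself is not in print (hence a Theorems helper, not a Literature fact).
-/

set_option linter.dupNamespace false -- layout D-0017: `AnomalousDissipation.AnomalousDissipation` repeats by design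

namespace Summit.AnomalousDissipation.AnomalousDissipation.Theorems.SolenoidalFractalHomogenisation.RealisedQuasiStaticCellLaw

noncomputable section

open Set Finset Complex
open scoped BigOperators ComplexConjugate

/-- Along an injective position map, at most two indices are adjacent to a given position `a`. -/
theorem card_filter_adjacent_le_two {ι : Type*} [Fintype ι] [DecidableEq ι] (pos : ι → ℤ)
    (hpos : Function.Injective pos) (a : ℤ) :
    (univ.filter fun K => pos K = a + 1 ∨ pos K = a - 1).card ≤ 2 := by
  calc (univ.filter fun K => pos K = a + 1 ∨ pos K = a - 1).card ≤ ({a + 1, a - 1} : Finset ℤ).card := by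
        refine Finset.card_le_card_of_injOn pos (fun K hK => ?_) (hpos.injOn)
        simp only [Finset.coe_filter, Finset.mem_univ, true_and, Set.mem_setOf_eq] at hK
        simp only [Finset.coe_insert, Finset.coe_singleton, Set.mem_insert_iff, Set.mem_singleton_iff]
        exact hK
    _ ≤ 2 := Finset.card_le_two

/-- A tridiagonal matrix (along an injective position map) has zero diagonal. -/
theorem tridiagonal_diag_eq_zero {ι : Type*} (S : Matrix ι ι ℂ) (pos : ι → ℤ)
    (htri : ∀ J K, S J K ≠ 0 → pos K = pos J + 1 ∨ pos K = pos J - 1) (o : ι) : S o o = 0 := by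
  by_contra h
  rcases htri o o h with h1 | h1 <;> linarith

/-- A row of a tridiagonal matrix with entries of modulus `≤ 1` has `Σ_J ‖S_{oJ}‖² ≤ 2`. -/
theorem tridiagonal_row_sq_le_two {ι : Type*} [Fintype ι] [DecidableEq ι] (S : Matrix ι ι ℂ) (pos : ι → ℤ)
    (hpos : Function.Injective pos) (htri : ∀ J K, S J K ≠ 0 → pos K = pos J + 1 ∨ pos K = pos J - 1)
    (hbd : ∀ J K, ‖S J K‖ ≤ 1) (o : ι) : ∑ J, ‖S o J‖ ^ 2 ≤ 2 := by
  set F := univ.filter fun K => pos K = pos o + 1 ∨ pos K = pos o - 1 with hF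
  have hsupp : ∀ J, J ∉ F → S o J = 0 := by
    intro J hJ
    by_contra h
    exact hJ (by rw [hF, Finset.mem_filter]; exact ⟨Finset.mem_univ _, htri o J h⟩)
  have h1 : ∑ J, ‖S o J‖ ^ 2 = ∑ J ∈ F, ‖S o J‖ ^ 2 := by
    rw [← Finset.sum_subset (Finset.subset_univ F)]
    intro J _ hJ
    rw [hsupp J hJ, norm_zero, zero_pow two_ne_zero]
  rw [h1]
  calc ∑ J ∈ F, ‖S o J‖ ^ 2 ≤ ∑ J ∈ F, (1 : ℝ) := Finset.sum_le_sum fun J _ => by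
          have := hbd o J
          have h0 := norm_nonneg (S o J)
          nlinarith
    _ = F.card := by simp
    _ ≤ 2 := by exact_mod_cast card_filter_adjacent_le_two pos hpos (pos o)

/-- Second-ring bound for a tridiagonal matrix with entries of modulus `≤ 1`: the row `o` of `S²`, off the
diagonal, has `Σ_{K ≠ o} ‖Σ_J S_{oJ} S_{JK}‖² ≤ 4 Σ_J ‖S_{oJ}‖²` (Cauchy–Schwarz over the two neighbours of `o`,
each of whose rows carries at most two entries). The sharp value for the ladder is `s₀²s₁² + s₋₁²s₋₂² ≤ γ²`. -/
theorem tridiagonal_secondRing_le {ι : Type*} [Fintype ι] [DecidableEq ι] (S : Matrix ι ι ℂ) (pos : ι → ℤ)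
    (hpos : Function.Injective pos) (htri : ∀ J K, S J K ≠ 0 → pos K = pos J + 1 ∨ pos K = pos J - 1)
    (hbd : ∀ J K, ‖S J K‖ ≤ 1) (o : ι) :
    ∑ K ∈ univ.erase o, ‖∑ J, S o J * S J K‖ ^ 2 ≤ 4 * ∑ J, ‖S o J‖ ^ 2 := by
  set F := univ.filter fun K => pos K = pos o + 1 ∨ pos K = pos o - 1 with hF
  have hsupp : ∀ J, J ∉ F → S o J = 0 := by
    intro J hJ
    by_contra h
    exact hJ (by rw [hF, Finset.mem_filter]; exact ⟨Finset.mem_univ _, htri o J h⟩)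
  have hγF : ∑ J, ‖S o J‖ ^ 2 = ∑ J ∈ F, ‖S o J‖ ^ 2 := by
    rw [← Finset.sum_subset (Finset.subset_univ F)]
    intro J _ hJ
    rw [hsupp J hJ, norm_zero, zero_pow two_ne_zero]
  have hcF : ∀ K, ∑ J, S o J * S J K = ∑ J ∈ F, S o J * S J K := by
    intro K
    rw [← Finset.sum_subset (Finset.subset_univ F)]
    intro J _ hJ
    rw [hsupp J hJ, zero_mul]
  -- each row carries at most two entries of modulus ≤ 1
  have hrow : ∀ J, ∑ K, ‖S J K‖ ^ 2 ≤ 2 := fun J => tridiagonal_row_sq_le_two S pos hpos htri hbd J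
  calc ∑ K ∈ univ.erase o, ‖∑ J, S o J * S J K‖ ^ 2
      ≤ ∑ K, ‖∑ J, S o J * S J K‖ ^ 2 :=
        Finset.sum_le_sum_of_subset_of_nonneg (Finset.erase_subset _ _) fun K _ _ => by positivity
    _ ≤ ∑ K, (∑ J ∈ F, ‖S o J‖ ^ 2) * ∑ J ∈ F, ‖S J K‖ ^ 2 :=
        Finset.sum_le_sum fun K _ => by rw [hcF K]; exact norm_sum_mul_sq_le F _ _
    _ = (∑ J, ‖S o J‖ ^ 2) * ∑ J ∈ F, ∑ K, ‖S J K‖ ^ 2 := by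
        rw [← Finset.mul_sum, Finset.sum_comm, ← hγF]
    _ ≤ (∑ J, ‖S o J‖ ^ 2) * ∑ J ∈ F, (2 : ℝ) :=
        mul_le_mul_of_nonneg_left (Finset.sum_le_sum fun J _ => hrow J)
          (Finset.sum_nonneg fun J _ => by positivity)
    _ ≤ (∑ J, ‖S o J‖ ^ 2) * 4 := by
        refine mul_le_mul_of_nonneg_left ?_ (Finset.sum_nonneg fun J _ => by positivity)
        rw [Finset.sum_const, nsmul_eq_mul]
        have := card_filter_adjacent_le_two pos hpos (pos o)
        have h2 : (F.card : ℝ) ≤ 2 := by exact_mod_cast this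
        linarith
    _ = 4 * ∑ J, ‖S o J‖ ^ 2 := by ring

/-- **Uniform decay of a truncated tridiagonal ladder block (the plan's §3.3 in its own terms).** Let `ι` be any
finite index set placed injectively on `ℤ` by `pos` (slow index `o` anywhere); let `S : Matrix ι ι ℂ` be
skew-Hermitian, tridiagonal along `pos` with entries of modulus `≤ 1`, coupling the slow mode
(`γ² = Σ_J ‖S_{oJ}‖² > 0`); let the damping `d` satisfy `0 ≤ d_o ≤ 1`, `d_J ≥ 1/2` for `J ≠ o` and `d_J ≤ 2` on the
neighbours `S_{oJ} ≠ 0`; rate `Λ > 0`; coupling `g(s) ∈ [g_lo, g_hi]` on `(a,b)` with `0 < g_lo ≤ g_hi`. Then every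
`v ∈ C⁰([a,b]) ∩ C¹((a,b))` with `v' = −Λ(Dv + g(s)Sv)` obeys
`Σ‖v_J(s)‖² ≤ (5/3)·exp(−Λγ²g_lo·min(g_lo, g_hi⁻¹)(s−a)/80)·Σ‖v_J(a)‖²` on `[a,b]`, uniformly in `ι`. -/
theorem ladderFunctional_decay_tridiagonal {ι : Type*} [Fintype ι] [DecidableEq ι] (S : Matrix ι ι ℂ)
    (d : ι → ℝ) (pos : ι → ℤ) (o : ι) (Λ g_lo g_hi γ2 a b : ℝ) (g : ℝ → ℝ) (v : ℝ → ι → ℂ)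
    (hpos : Function.Injective pos)
    (hS : ∀ J K, S K J = -conj (S J K)) (htri : ∀ J K, S J K ≠ 0 → pos K = pos J + 1 ∨ pos K = pos J - 1)
    (hbd : ∀ J K, ‖S J K‖ ≤ 1) (hγ : γ2 = ∑ J, ‖S o J‖ ^ 2) (hγpos : 0 < γ2)
    (hdo : 0 ≤ d o) (hdo1 : d o ≤ 1) (hd : ∀ J, J ≠ o → 1 / 2 ≤ d J) (hd1 : ∀ J, S o J ≠ 0 → d J ≤ 2)
    (hΛ : 0 < Λ) (hglo : 0 < g_lo) (hghi : g_lo ≤ g_hi) (hg : ∀ s ∈ Ioo a b, g_lo ≤ g s ∧ g s ≤ g_hi)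
    (hcont : ContinuousOn v (Icc a b))
    (hderiv : ∀ s ∈ Ioo a b, HasDerivAt v
        (fun J => -(Λ : ℂ) * ((d J : ℂ) * v s J + (g s : ℂ) * ∑ K, S J K * v s K)) s) :
    ∀ s ∈ Icc a b, ∑ J, ‖v s J‖ ^ 2 ≤
      5 / 3 * Real.exp (-(Λ * γ2 * g_lo * min g_lo g_hi⁻¹ / 80) * (s - a)) * ∑ J, ‖v a J‖ ^ 2 := by
  exact ladderFunctional_decay_explicit S d o Λ g_lo g_hi γ2 a b g v hS (tridiagonal_diag_eq_zero S pos htri o) hγ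
    hγpos (hγ ▸ tridiagonal_row_sq_le_two S pos hpos htri hbd o)
    (hγ ▸ tridiagonal_secondRing_le S pos hpos htri hbd o) hdo hdo1 hd hd1 hΛ hglo hghi hg hcont hderiv

/-! ## The integer-window form the S1D closer calls (consumer interface, 2026-08-27 INTERFACE NOTE) -/

/-- **Uniform decay of a Dirichlet-truncated three-term ladder on an integer window** — the shape in which the S1D
closer meets F2 (K2R lead, INTERFACE NOTE 2026-08-27T16:34Z): a finite window `W ⊆ ℤ` containing `−1, 0, 1`, real
links `s : ℤ → ℝ` with `|s_J| ≤ 1` on `W` and `γ² = s₀² + s₋₁² > 0`, real damping `d : ℤ → ℝ` with `0 ≤ d₀ ≤ 1`,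
`d_J ≥ 1/2` on `W ∖ {0}`, `d_{±1} ≤ 2`, a rate `Λ > 0`, a coupling `g(t) ∈ [g_lo, g_hi]` on `(t₀,t₁)` with
`0 < g_lo ≤ g_hi`, and a state `v : ℝ → ℤ → ℂ` vanishing off `W` on `[t₀,t₁]` whose window coordinates satisfy, in
ORIGINAL time, `HasDerivWithinAt (v · J) (−Λ(d_J v_J) − g(t)Λ(s_{J−1}v_{J−1} − s_J v_{J+1})) (Icc t₀ t₁) t` for all
`t ∈ [t₀,t₁]`, `J ∈ W`. Then for all `t ∈ [t₀,t₁]`: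
`Σ_{J∈W} ‖v t J‖² ≤ (5/3)·exp(−Λγ²g_lo·min(g_lo, g_hi⁻¹)(t−t₀)/80)·Σ_{J∈W} ‖v t₀ J‖²`, with constants independent
of `W`. (The ladder matrix `S_{J,J−1} = s_{J−1}`, `S_{J,J+1} = −s_J` is real antisymmetric tridiagonal, so
`ladderFunctional_decay_tridiagonal` applies on the subtype `↥W`; missing neighbours contribute `0` by the support
hypothesis.) -/
theorem ladderFunctional_decay_intWindow (W : Finset ℤ) (h0 : (0 : ℤ) ∈ W) (h1 : (1 : ℤ) ∈ W) (hm1 : (-1 : ℤ) ∈ W)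
    (d s : ℤ → ℝ) (Λ g_lo g_hi t₀ t₁ : ℝ) (g : ℝ → ℝ) (v : ℝ → ℤ → ℂ)
    (hs : ∀ J ∈ W, |s J| ≤ 1) (hγpos : 0 < s 0 ^ 2 + s (-1) ^ 2)
    (hd0 : 0 ≤ d 0) (hd0' : d 0 ≤ 1) (hd : ∀ J ∈ W, J ≠ 0 → 1 / 2 ≤ d J) (hd1 : d 1 ≤ 2) (hdm1 : d (-1) ≤ 2)
    (hΛ : 0 < Λ) (hglo : 0 < g_lo) (hghi : g_lo ≤ g_hi) (hg : ∀ t ∈ Ioo t₀ t₁, g_lo ≤ g t ∧ g t ≤ g_hi)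
    (hsupp : ∀ t ∈ Icc t₀ t₁, ∀ J, J ∉ W → v t J = 0)
    (hderiv : ∀ t ∈ Icc t₀ t₁, ∀ J ∈ W, HasDerivWithinAt (fun τ => v τ J)
        (-(Λ : ℂ) * ((d J : ℂ) * v t J) -
          (g t : ℂ) * (Λ : ℂ) * ((s (J - 1) : ℂ) * v t (J - 1) - (s J : ℂ) * v t (J + 1))) (Icc t₀ t₁) t) :
    ∀ t ∈ Icc t₀ t₁, ∑ J ∈ W, ‖v t J‖ ^ 2 ≤
      5 / 3 * Real.exp (-(Λ * (s 0 ^ 2 + s (-1) ^ 2) * g_lo * min g_lo g_hi⁻¹ / 80) * (t - t₀)) *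
        ∑ J ∈ W, ‖v t₀ J‖ ^ 2 := by
  intro t ht
  -- the ladder matrix on `ℤ` and its restriction to the window
  set Srow : ℤ → ℤ → ℂ := fun J K =>
    if K = J - 1 then ((s (J - 1) : ℝ) : ℂ) else if K = J + 1 then -((s J : ℝ) : ℂ) else 0 with hSrow
  set S' : Matrix W W ℂ := fun J K => Srow J K with hS'
  set d' : W → ℝ := fun J => d J with hd'
  set o : W := ⟨0, h0⟩ with ho
  set u : ℝ → W → ℂ := fun τ J => v τ J with hu
  have hSrow_apply : ∀ J K : ℤ, Srow J K =
      if K = J - 1 then ((s (J - 1) : ℝ) : ℂ) else if K = J + 1 then -((s J : ℝ) : ℂ) else 0 := fun J K => rfl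
  -- skew-symmetry, tridiagonality, entry bound
  have hSrow_skew : ∀ J K : ℤ, Srow K J = -conj (Srow J K) := by
    intro J K
    rw [hSrow_apply K J, hSrow_apply J K]
    by_cases h1 : J = K - 1
    · have h2 : K = J + 1 := by omega
      have h3 : ¬ K = J - 1 := by omega
      rw [if_pos h1, if_neg h3, if_pos h2]
      simp only [map_neg, Complex.conj_ofReal, neg_neg]
      rw [h1]
    · by_cases h4 : J = K + 1
      · have h5 : K = J - 1 := by omega
        rw [if_neg h1, if_pos h4, if_pos h5]
        simp only [Complex.conj_ofReal]
        rw [h5]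
      · have h6 : ¬ K = J - 1 := by omega
        have h7 : ¬ K = J + 1 := by omega
        rw [if_neg h1, if_neg h4, if_neg h6, if_neg h7]
        simp
  have hSkew : ∀ J K : W, S' K J = -conj (S' J K) := fun J K => hSrow_skew J K
  have htri : ∀ J K : W, S' J K ≠ 0 → (K : ℤ) = J + 1 ∨ (K : ℤ) = J - 1 := by
    intro J K hJK
    have h : Srow J K ≠ 0 := hJK
    rw [hSrow_apply] at h
    split_ifs at h with ha hb
    · exact Or.inr ha
    · exact Or.inl hb
    · exact absurd rfl h
  have hbd : ∀ J K : W, ‖S' J K‖ ≤ 1 := by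
    intro J K
    show ‖Srow J K‖ ≤ 1
    rw [hSrow_apply]
    split_ifs with ha hb
    · rw [Complex.norm_real, Real.norm_eq_abs, ← ha]; exact hs K K.2
    · rw [norm_neg, Complex.norm_real, Real.norm_eq_abs]; exact hs J J.2
    · simp
  -- the slow row: `γ² = s₀² + s₋₁²`
  have hrow0 : ∀ K : ℤ, Srow 0 K = if K = -1 then ((s (-1) : ℝ) : ℂ) else if K = 1 then -((s 0 : ℝ) : ℂ) else 0 := by
    intro K; rw [hSrow_apply]; norm_num
  have hγ : s 0 ^ 2 + s (-1) ^ 2 = ∑ J : W, ‖S' o J‖ ^ 2 := by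
    have : ∑ J : W, ‖S' o J‖ ^ 2 = ∑ J ∈ W, ‖Srow 0 J‖ ^ 2 := Finset.sum_coe_sort W (fun J => ‖Srow 0 J‖ ^ 2)
    rw [this, Finset.sum_eq_add (-1) 1 (by norm_num)]
    · rw [hrow0, hrow0]
      simp only [if_true, show ¬ ((1 : ℤ) = -1) by norm_num, if_false, norm_neg, Complex.norm_real,
        Real.norm_eq_abs, sq_abs]
      ring
    · intro K _ hK
      rw [hrow0, if_neg hK.1, if_neg hK.2, norm_zero, zero_pow two_ne_zero]
    · intro h; exact absurd hm1 h
    · intro h; exact absurd h1 h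
  -- damping hypotheses on the subtype
  have hd'' : ∀ J : W, J ≠ o → 1 / 2 ≤ d' J := by
    intro J hJ
    have : (J : ℤ) ≠ 0 := fun h => hJ (Subtype.ext h)
    exact hd J J.2 this
  have hd1'' : ∀ J : W, S' o J ≠ 0 → d' J ≤ 2 := by
    intro J hJ
    rcases htri o J hJ with h | h
    · have hJ1 : (J : ℤ) = 1 := by simpa [ho] using h
      show d J ≤ 2; rw [hJ1]; exact hd1
    · have hJ1 : (J : ℤ) = -1 := by simpa [ho] using h
      show d J ≤ 2; rw [hJ1]; exact hdm1
  -- the trajectory on the subtype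
  have hcont : ContinuousOn u (Icc t₀ t₁) :=
    continuousOn_pi.2 fun J τ hτ => (hderiv τ hτ J J.2).continuousWithinAt
  have hfield : ∀ τ ∈ Icc t₀ t₁, ∀ J : W, ∑ K : W, S' J K * u τ K =
      ((s ((J : ℤ) - 1) : ℝ) : ℂ) * v τ (J - 1) - ((s J : ℝ) : ℂ) * v τ (J + 1) := by
    intro τ hτ J
    have e1 : ∑ K : W, S' J K * u τ K = ∑ K ∈ W, Srow J K * v τ K :=
      Finset.sum_coe_sort W (fun K => Srow J K * v τ K)
    rw [e1, Finset.sum_eq_add ((J : ℤ) - 1) ((J : ℤ) + 1) (by omega)]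
    · rw [hSrow_apply, if_pos rfl, hSrow_apply, if_neg (by omega), if_pos rfl]
      ring
    · intro K _ hK
      rw [hSrow_apply, if_neg hK.1, if_neg hK.2, zero_mul]
    · intro h; rw [hsupp τ hτ _ h, mul_zero]
    · intro h; rw [hsupp τ hτ _ h, mul_zero]
  have hderiv' : ∀ τ ∈ Ioo t₀ t₁, HasDerivAt u
      (fun J => -(Λ : ℂ) * ((d' J : ℂ) * u τ J + (g τ : ℂ) * ∑ K, S' J K * u τ K)) τ := by
    intro τ hτ
    have hτ' : τ ∈ Icc t₀ t₁ := Ioo_subset_Icc_self hτ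
    refine hasDerivAt_pi.2 fun J => ?_
    have h := (hderiv τ hτ' J J.2).hasDerivAt (Icc_mem_nhds hτ.1 hτ.2)
    rw [hfield τ hτ' J]
    convert h using 1
    show -(Λ : ℂ) * ((d J : ℂ) * v τ J + (g τ : ℂ) * (((s ((J : ℤ) - 1) : ℝ) : ℂ) * v τ (J - 1) -
      ((s J : ℝ) : ℂ) * v τ (J + 1))) = _
    ring
  have key := ladderFunctional_decay_tridiagonal S' d' Subtype.val o Λ g_lo g_hi (s 0 ^ 2 + s (-1) ^ 2) t₀ t₁ g u
    Subtype.val_injective hSkew htri hbd hγ hγpos hd0 hd0' hd'' hd1'' hΛ hglo hghi hg hcont hderiv' t ht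
  have e1 : ∑ J : W, ‖u t J‖ ^ 2 = ∑ J ∈ W, ‖v t J‖ ^ 2 := Finset.sum_coe_sort W (fun J => ‖v t J‖ ^ 2)
  have e2 : ∑ J : W, ‖u t₀ J‖ ^ 2 = ∑ J ∈ W, ‖v t₀ J‖ ^ 2 := Finset.sum_coe_sort W (fun J => ‖v t₀ J‖ ^ 2)
  rw [e1, e2] at key
  exact key

end

end Summit.AnomalousDissipation.AnomalousDissipation.Theorems.SolenoidalFractalHomogenisation.RealisedQuasiStaticCellLaw
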